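import Summits.HubbardSuperconductivity.HubbardSuperconductivity.Theorems.AnisotropyChordChordFMOfPieces
import Summits.HubbardSuperconductivity.HubbardSuperconductivity.Theorems.AnisotropyChordFerroSideChordOfLargeSixEight
import Summits.HubbardSuperconductivity.HubbardSuperconductivity.Theorems.AnisotropyChordChordXYFour
import Summits.HubbardSuperconductivity.HubbardSuperconductivity.Theorems.AnisotropyChordChordFMFour

/-!
# Route `AnisotropyChord`, cruxes `ChordXY` (stmt-8146) and `ChordFM` (stmt-8147): the two chords
# from their STILL-OPEN pieces only (glue over the proved items and the certified `M = 4` instances)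

The registered skeleton `9dce51c1…` of `ChordFM` (line `split_chordxy_ferroside`) has the stubs
`stub_chordXY : ChordXY` (= item stmt-8146) and `stub_ferroSideChord : FerroSideChord` (= item
stmt-19089), BY NAME. Since its registration the tree acquired: the split of `FerroSideChord` into
`FerroSideChordLarge` (stmt-23918, even `M ≥ 9`, OPEN) / `FerroSideChordSmall` (stmt-23919,
`4 ≤ M ≤ 8`, OPEN) / `FerroSideChordEndpoints` (stmt-23920, PROVED) with glue `FerroSideChordOfPieces`
(stmt-23921, PROVED) and the bookkeeping `FerroSide.ferroSideChord_of_large_small`,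
`FerroSide.ferroSideChord_of_large_six_eight`; the split glue `ChordFMOfPieces` (stmt-19090, PROVED);
and the kernel-certified `M = 4` instances `FourTorus.chordXY_four`, `FourTorus.chordFM_four`.

Substituting all of these, the EXACT remaining-lemma lists are:

* `chordXY_of_six_le` — **`ChordXY` ⇐ its own body for even `M ≥ 6`** (the `M = 4` instance is the
  tree theorem `chordXY_four`);
* `chordFM_of_six_le` — **`ChordFM` ⇐ its own body for even `M ≥ 6`** (`chordFM_four`);
* `chordFM_of_open_pieces` — **`ChordFM` ⇐ `ChordXY` ∧ `FerroSideChordLarge` ∧ `FerroSideChordSmall`**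
  (items stmt-8146, stmt-23918, stmt-23919 and nothing else);
* `chordFM_of_chordXY_large_six_eight` — **`ChordFM` ⇐ `ChordXY` ∧ `FerroSideChordLarge` ∧ (the
  FM-side chord at `M = 6`) ∧ (at `M = 8`)** on the open interval `Δ ∈ (0,1)`.

Pure logic over landed theorems; none of the remaining pieces is proved here and no crux closes.
[bookkeeping]
-/

set_option linter.dupNamespace false

noncomputable section

open Matrix
open Literature.MathematicalPhysics.QuantumLattice Literature.Probability.LatticeModels
open Summit.HubbardSuperconductivity.HubbardSuperconductivity.Theses.AnisotropyChord
open Summit.HubbardSuperconductivity.HubbardSuperconductivity.Theorems.AnisotropyChord.FourTorus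
  (chordXY_four chordFM_four)
open Summit.HubbardSuperconductivity.HubbardSuperconductivity.Theorems.AnisotropyChord.FerroSide
  (ferroSideChord_of_large_small ferroSideChord_of_large_six_eight)

namespace Summit.HubbardSuperconductivity.HubbardSuperconductivity.Theorems.AnisotropyChord

/-- An even natural number with `4 ≤ M < 6` is `4`. [bookkeeping] -/
theorem eq_four_of_even_of_lt_six {M : ℕ} (hE : Even M) (h4 : 4 ≤ M) (h6 : M < 6) : M = 4 := by
  interval_cases M
  · rfl
  · exact absurd hE (by decide)

/-- **`ChordXY` from its instances at even `M ≥ 6`.** The `M = 4` instance of the crux is the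
kernel-certified tree theorem `FourTorus.chordXY_four`; so the crux `ChordXY` (stmt-8146) is
equivalent to its own body restricted to even `M ≥ 6`. [bookkeeping] -/
theorem chordXY_of_six_le
    (h : ∀ (M : ℕ) [NeZero M], Even M → 6 ≤ M → ∀ Δ ∈ Set.Icc (-1:ℝ) 0,
      ∀ (ψ₀ ψ : TensorIndex (TorusSite 2 M) 2 → ℂ),
      ψ₀ ∈ spinZSector (Λ := TorusSite 2 M) 1 0 → star ψ₀ ⬝ᵥ ψ₀ = 1 →
      Matrix.mulVec (xxzHamiltonian 1 (torusGraph 2 M) (-1) 0) ψ₀ =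
        ((lowestEnergyInSector 1 (xxzHamiltonian 1 (torusGraph 2 M) (-1) 0) 0 : ℝ) : ℂ) • ψ₀ →
      ψ ∈ spinZSector (Λ := TorusSite 2 M) 1 0 → star ψ ⬝ᵥ ψ = 1 →
      Matrix.mulVec (xxzHamiltonian 1 (torusGraph 2 M) (-1) Δ) ψ =
        ((lowestEnergyInSector 1 (xxzHamiltonian 1 (torusGraph 2 M) (-1) Δ) 0 : ℝ) : ℂ) • ψ →
      (1 + Δ) * (star ψ₀ ⬝ᵥ Matrix.mulVec ((∑ x : TorusSite 2 M, onSite x (spinRaise 1)) *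
          (∑ y : TorusSite 2 M, onSite y (spinLower 1))) ψ₀).re ≤
        (star ψ ⬝ᵥ Matrix.mulVec ((∑ x : TorusSite 2 M, onSite x (spinRaise 1)) *
          (∑ y : TorusSite 2 M, onSite y (spinLower 1))) ψ).re) :
    ChordXY := by
  intro M _ hE h4 Δ hΔ ψ₀ ψ hmem₀ hψ₀1 heig₀ hmem hψ1 heig
  rcases Nat.lt_or_ge M 6 with hlt | hge
  · obtain rfl : M = 4 := eq_four_of_even_of_lt_six hE h4 hlt
    exact chordXY_four Δ hΔ ψ₀ ψ hmem₀ hψ₀1 heig₀ hmem hψ1 heig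
  · exact h M hE hge Δ hΔ ψ₀ ψ hmem₀ hψ₀1 heig₀ hmem hψ1 heig

/-- **`ChordFM` from its instances at even `M ≥ 6`.** The `M = 4` instance is the kernel-certified
tree theorem `FourTorus.chordFM_four`; so the crux `ChordFM` (stmt-8147) is equivalent to its own
body restricted to even `M ≥ 6`. [bookkeeping] -/
theorem chordFM_of_six_le
    (h : ∀ (M : ℕ) [NeZero M], Even M → 6 ≤ M → ∀ Δ ∈ Set.Icc (-1:ℝ) 1,
      ∀ (ψ : TensorIndex (TorusSite 2 M) 2 → ℂ),
      ψ ∈ spinZSector (Λ := TorusSite 2 M) 1 0 → star ψ ⬝ᵥ ψ = 1 →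
      Matrix.mulVec (xxzHamiltonian 1 (torusGraph 2 M) (-1) Δ) ψ =
        ((lowestEnergyInSector 1 (xxzHamiltonian 1 (torusGraph 2 M) (-1) Δ) 0 : ℝ) : ℂ) • ψ →
      (1 + Δ) / 2 * ((M : ℝ) ^ 2 / 2 * ((M : ℝ) ^ 2 / 2 + 1)) ≤
        (star ψ ⬝ᵥ Matrix.mulVec ((∑ x : TorusSite 2 M, onSite x (spinRaise 1)) *
          (∑ y : TorusSite 2 M, onSite y (spinLower 1))) ψ).re) :
    ChordFM := by
  intro M _ hE h4 Δ hΔ ψ hmem hψ1 heig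
  rcases Nat.lt_or_ge M 6 with hlt | hge
  · obtain rfl : M = 4 := eq_four_of_even_of_lt_six hE h4 hlt
    exact chordFM_four Δ hΔ ψ hmem hψ1 heig
  · exact h M hE hge Δ hΔ ψ hmem hψ1 heig

/-- **The crux `ChordFM` (stmt-HubbardSuperconductivity-8147) from exactly its three open pieces**:
`ChordXY` (stmt-8146), `FerroSideChordLarge` (stmt-23918) and `FerroSideChordSmall` (stmt-23919) imply
`ChordFM` — the split glue `chordFMOfPieces_proof` (stmt-19090) composed with
`FerroSide.ferroSideChord_of_large_small` (pieces stmt-23920/23921 proved). This is the remaining-lemma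
list of the registered skeleton `9dce51c1…` (stubs `stub_chordXY`, `stub_ferroSideChord`).
[bookkeeping] -/
theorem chordFM_of_open_pieces (hXY : ChordXY) (hL : FerroSideChordLarge) (hS : FerroSideChordSmall) :
    ChordFM :=
  chordFMOfPieces_proof hXY (ferroSideChord_of_large_small hL hS)

/-- **`ChordFM` from `ChordXY`, `FerroSideChordLarge` and the FM-side chord at `M = 6` and `M = 8`**
(open interval `Δ ∈ (0,1)`; `M = 4` certified, endpoints by continuity —
`FerroSide.ferroSideChord_of_large_six_eight`). [bookkeeping] -/
theorem chordFM_of_chordXY_large_six_eight (hXY : ChordXY) (hA : FerroSideChordLarge)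
    (h6 : ∀ Δ ∈ Set.Ioo (0:ℝ) 1, ∀ (ψ : TensorIndex (TorusSite 2 6) 2 → ℂ),
      ψ ∈ spinZSector (Λ := TorusSite 2 6) 1 0 → star ψ ⬝ᵥ ψ = 1 →
      Matrix.mulVec (xxzHamiltonian 1 (torusGraph 2 6) (-1) Δ) ψ =
        ((lowestEnergyInSector 1 (xxzHamiltonian 1 (torusGraph 2 6) (-1) Δ) 0 : ℝ) : ℂ) • ψ →
      (1 + Δ) / 2 * (((6 : ℕ) : ℝ) ^ 2 / 2 * (((6 : ℕ) : ℝ) ^ 2 / 2 + 1)) ≤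
        (star ψ ⬝ᵥ Matrix.mulVec ((∑ x : TorusSite 2 6, onSite x (spinRaise 1)) *
          (∑ y : TorusSite 2 6, onSite y (spinLower 1))) ψ).re)
    (h8 : ∀ Δ ∈ Set.Ioo (0:ℝ) 1, ∀ (ψ : TensorIndex (TorusSite 2 8) 2 → ℂ),
      ψ ∈ spinZSector (Λ := TorusSite 2 8) 1 0 → star ψ ⬝ᵥ ψ = 1 →
      Matrix.mulVec (xxzHamiltonian 1 (torusGraph 2 8) (-1) Δ) ψ =
        ((lowestEnergyInSector 1 (xxzHamiltonian 1 (torusGraph 2 8) (-1) Δ) 0 : ℝ) : ℂ) • ψ →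
      (1 + Δ) / 2 * (((8 : ℕ) : ℝ) ^ 2 / 2 * (((8 : ℕ) : ℝ) ^ 2 / 2 + 1)) ≤
        (star ψ ⬝ᵥ Matrix.mulVec ((∑ x : TorusSite 2 8, onSite x (spinRaise 1)) *
          (∑ y : TorusSite 2 8, onSite y (spinLower 1))) ψ).re) :
    ChordFM :=
  chordFMOfPieces_proof hXY (ferroSideChord_of_large_six_eight hA h6 h8)

end Summit.HubbardSuperconductivity.HubbardSuperconductivity.Theorems.AnisotropyChord

end
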